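import Literature.MathematicalPhysics.QuantumFieldTheory.Balaban1983to89.B6Partition118KLevelFineL0
import Literature.MathematicalPhysics.QuantumFieldTheory.Balaban1983to89.B6Partition118KLevelFineSizes
/-!
# `Balaban1983to89.B6Partition118KLevelFineSizesL0` — LEVEL-0 TWIN (programme G-F3′-L0, director-ym LINE №27 / UV3-NODE §24.5; plan `lit-balaban-r03/G-F3L0-PLAN.md`) of `B6Partition118KLevelFineSizes`:
the same declarations, SAME NAMES AND STATEMENTS, for nested families WITH print's region `Λ₀ = T ∖ Ω₁` ADMITTED (structures
`B6MultiLevelBoxOperatorL0.Domains` / `B6MultiLevelTorusOperatorL0.TDomains`: levels `0, …, k`, the level-`0` block a single site, `Q′₀ = id`,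
finite weight `a₀` — print p.225 (2.14) «Σ_{j=0}^k … (Q′₀λ)(x) = λ(x), x ∈ Λ₀», p.229 «taking a sequence (2.1) … smallest possible domains B^j(Λ_j),
and considering the operator Δ_a defined by (2.19), (2.20) for this sequence»).  Every `D`-free object is the lineage's, consumed BY NAME; no existing
module is touched; no fact is minted.  Unit `lit-balaban-r03` (B6 fold owner, r03 gen 36); referee ref-4.  THE TWIN'S DOCUMENTATION FOLLOWS
VERBATIM (its «levels 1 … k» / «Ω₁ = X» sentences describe the twin; here `j` runs from `0` and `Ω₁` may be a proper subset).

# `Balaban1983to89.B6Partition118KLevelFineSizes` — T. Bałaban, *Propagators and renormalization transformations for lattice gauge theories. II*,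
# Commun. Math. Phys. **96** (1984) 223–250 [Balaban1984PropagatorsII], p. 229 (2.36) / p. 239 (2.92) line 1 / p. 247: THE SIZES OF THE SMOOTH FINE-LATTICE
# PARTITION `{h_□}` OF `…B6Partition118KLevelFine` — finite overlap at fine sites, comparability of the scales of the cubes active at one site, and
# **`|h_□(x′) − h_□(x)| ≤ C₁/S_□` for neighbouring fine sites** (`S_□ = 8ML^j/5` fine sites; `C₁` depends on `d, L` only) = the line-1 size
# `|∂^ηh_□| ≤ O(1)(ML^jη)^{−1}` consumed by (2.134) (file 2 of the family; the second differences are file 3)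

statement-level skeleton of published theorems with citation tags; proofs where landed; nothing here is a claim about the Yang–Mills mass gap

PDF held: `paper:balaban1984-cmp96-propagators-rt-ii` (journal page = PDF page + 222): p. 229 [PDF 7], p. 239 [PDF 17], p. 247 [PDF 25]; read from the tree
transcriptions (`…B6Cover236MultiLevelBlocks`, `…B6Eq291Generator`, `…B6Ineq2134Diag`).  PRINT p. 239 (2.92), line 1: *"(K_{□,□}A)_μ(x) = ([h_□Δ − Δh_□]
G_□h_□A)_μ(x) + …"*; p. 247: *"the bound of G_□ is multiplied by θ … we get the estimate … with O(1)M^{−1} instead of θ"* — the commutator `[h_□, Δ]`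
costs the sizes of `∂h_□`, `Δh_□`, which for the (1.118) family at scale `ML^jη` are `O(1)(ML^jη)^{−1}` and `O(1)(ML^jη)^{−2} ≤ O(1)M^{−1}(L^jη)^{−2}`.

CITATION HEADER (lean-in-tree rule) — WHAT IS REPRODUCED.  Phase-2 file of the `lit-balaban` typed skeleton (HOME `run/shared/lean/pub/lit-balaban/`), seat
**p38 gen 25**; offer (1) of B6-CLOSURE §5 item 7 (owner r03 g18, 2026-08-22T22:35:35Z), FILE 2; SKELETON rows **B6.Eq2.36** × **B5.Eq1.118** ×
**B6.Eq2.134** (cells only; decls of record untouched; referee ref-4).  File 1 (`…B6Partition118KLevelFine`, p343763) built `thetaF`/`hF` and proved (2.36),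
the support and the level window.  THIS FILE proves the SIZES of `hF D □` at fine sites `x` of the box of p21's `D : Domains d ℓ M_h k P R` (`L = ℓ + 1 ≥ 2`,
`M = L·M_h`, `S = side D □ = ML^j`):
* §1 the real-variable calculus of `θ/N^{1/2}`, `N ≥ 1`, first differences: `|N′^{−1/2} − N^{−1/2}| ≤ ½|N′ − N|` (`inv_sqrt_sub_le`), the quotient
  rule, squares;
* §2 **FINITE OVERLAP AT FINE SITES**: the cubes whose collar `{|p − ctr|_∞ < 3S/2}` contains a fine site `x` have level `lev x − 1 … lev x + 1` (file 1's
  window) and at most three labels per coordinate: **`#{□ : |x − ctr_□|_∞ < 3S_□/2} ≤ 3^{d+2}`** (`card_collar_le`; p21's count was at block centres);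
* §3 **COMPARABLE SCALES**: two cubes whose `3S/2`-collars share a fine site have levels within `2`, so `S_□ ≤ L²·S_{□′}` (p21's `side_le_Lsq_mul_side`);
* §4 **FIRST DIFFERENCES**: for fine sites at sup-distance `≤ ρ ≤ S_□/(2L²)`, `|hF □ x′ − hF □ x| ≤ C1F d ℓ·ρ/(8S_□/5)` (`abs_hF_sub_le_of_dist_le`),
  `C1F = (d+1)D₁(1 + 3^{d+2}L²)`; neighbours (`ρ = 1`, `M_h ≥ 2`): `≤ C1F d ℓ/(8S_□/5)` (`abs_hF_sub_le_near`);
* the SECOND differences `|hF □ (x + e_μ) − 2·hF □ x + hF □ (x − e_μ)| ≤ C₂/(8S_□/5)²` are file 3 (`…B6Partition118KLevelFineSecond`, same method: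
  the quotient rule for second differences over the same active set).
No new fact; one closed-form constant (`C1F`, a def); standard axioms.
HONEST SCOPE. Constants are `L`- and `d`-dependent, `k`-, `M_h`-independent (all (2.134)/(2.85) use: *"O(M^{−1}) … for M large enough"*); the `d`-metric
Lipschitz bound `(s/M)(d(y, y′) + r₀)` and the sets `S_□ ⊆ T_□`, `Score_□`, the gap — the remaining binders — follow (p21's `disp_or_far` /
`gap_of_cubeInd_eq_zero` by name).  Integer box; nothing on d = 4 or the continuum; NOT summit progress.  Unit `lit-balaban-p38` (gen 25), 2026-08-22.
-/

namespace Literature.MathematicalPhysics.QuantumFieldTheory.Balaban1983to89.B6Partition118KLevelFineSizesL0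

open Finset
open Literature.MathematicalPhysics.QuantumFieldTheory.Balaban1983to89.B4ContourShift (supNorm)
open Literature.MathematicalPhysics.QuantumFieldTheory.Balaban1983to89.B4Reflection242 (boxDom mem_boxDom blk)
open Literature.MathematicalPhysics.QuantumFieldTheory.Balaban1983to89.B6MultiLevelBoxOperator hiding Domains mlOp_apply
open Literature.MathematicalPhysics.QuantumFieldTheory.Balaban1983to89.B6MultiLevelBoxOperatorL0
open Literature.MathematicalPhysics.QuantumFieldTheory.Balaban1983to89.B6Geom246MultiLevelBox hiding Touch blkOf blkOf_corner blkOf_eq_iff_blk blkOf_eq_of_blk_i_eq blkOf_val bond bond_adj bset cen connected coord_bounds corner corner_mem csys dist_blkOf_le_box dist_blkOf_le_coord dist_blkOf_le_line dist_cen_le_of_adj dist_cen_le_of_touch dist_le_one_of_near dist_toR_cen_le exists_blkOf_eq geom lemma21_box lev_corner lev_eq_of_blkOf_eq levelGap pack reachable_blkOf reachable_of_near realizes scale_bounds touch_symm triangle_refl_nonneg walk_disp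
open Literature.MathematicalPhysics.QuantumFieldTheory.Balaban1983to89.B6Geom246MultiLevelBoxL0
open Literature.MathematicalPhysics.QuantumFieldTheory.Balaban1983to89.B6Cover236MultiLevelBlocksL0 (cubes side side_eq side_pos ctr side_le_Lsq_mul_side)
open Literature.MathematicalPhysics.QuantumFieldTheory.Balaban1983to89.B4PartitionUnity22
  (hprof contDiff_hprof hasCompactSupport_hprof D1 D2 D1_nonneg D2_nonneg)
open Literature.MathematicalPhysics.QuantumFieldTheory.Balaban1983to89.B6Partition118KLevelFineL0 (sF sF_pos thetaF thetaF_nonneg thetaF_le_one dist_lt_of_thetaF_ne_zero abs_thetaF_sub_le abs_thetaF_axis_diff_le abs_thetaF_axis_second_diff_le nsqF one_le_nsqF hF lev_window_of_dist_lt_three_halves)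
open Literature.MathematicalPhysics.QuantumFieldTheory.Balaban1983to89.B6Partition118KLevelFineSizes (inv_sqrt_sub_le abs_sq_sub_sq_le C1F C1F_nonneg)

variable {d : ℕ} {ℓ Mh k R : ℕ} {P : Fin (d + 1) → ℕ} (D : Domains d ℓ Mh k P R)

/-! ## §1  The calculus of `θ/N^{1/2}`, first differences (real variables) -/

section Real

/-- the quotient rule, first differences: `f, f′ ∈ [0,1]`, `N, N′ ≥ 1` ⟹ `|f′/√N′ − f/√N| ≤ |f′ − f| + ½|N′ − N|`. [folklore] -/
private theorem quot_diff_le {f f' N N' : ℝ} (hf0 : 0 ≤ f) (hf1 : f ≤ 1) (hN : 1 ≤ N) (hN' : 1 ≤ N') :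
    |f' / Real.sqrt N' - f / Real.sqrt N| ≤ |f' - f| + |N' - N| / 2 := by
  have hs' : 1 ≤ Real.sqrt N' := by rw [← Real.sqrt_one]; exact Real.sqrt_le_sqrt hN'
  have e : f' / Real.sqrt N' - f / Real.sqrt N = (f' - f) / Real.sqrt N' + f * ((Real.sqrt N')⁻¹ - (Real.sqrt N)⁻¹) := by
    rw [div_eq_mul_inv, div_eq_mul_inv, div_eq_mul_inv]; ring
  rw [e]
  refine (abs_add_le _ _).trans (add_le_add ?_ ?_)
  · rw [abs_div, abs_of_pos (by linarith : 0 < Real.sqrt N')]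
    exact div_le_self (abs_nonneg _) hs'
  · rw [abs_mul, abs_of_nonneg hf0]
    calc f * |(Real.sqrt N')⁻¹ - (Real.sqrt N)⁻¹| ≤ 1 * (|N' - N| / 2) :=
          mul_le_mul hf1 (inv_sqrt_sub_le hN hN') (abs_nonneg _) zero_le_one
      _ = |N' - N| / 2 := one_mul _

end Real

/-! ## §2  Finite overlap at fine sites -/

/-- `S ≥ 2` (`L ≥ 2`, `M_h ≥ 1`, level `≥ 0`). [cite: Balaban1984PropagatorsII, (2.1) p.224, bookkeeping] -/
theorem two_le_side (hℓ : 1 ≤ ℓ) (hMh : 1 ≤ Mh) (i : ↥(B6Cover236MultiLevelBlocksL0.cubes D)) : 2 ≤ side D i := by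
  rw [side_eq]
  have h1 : 2 ≤ (ℓ + 1) ^ (i.1.1 + 1) :=
    le_trans (by omega : 2 ≤ ℓ + 1) (Nat.le_self_pow (by omega) _)
  have h1r : (2 : ℝ) ≤ (((ℓ + 1) ^ (i.1.1 + 1) : ℕ) : ℝ) := by exact_mod_cast h1
  have hMr : (1 : ℝ) ≤ Mh := by exact_mod_cast hMh
  nlinarith

/-- the label of a cube whose collar `{|p − ctr|_∞ < 3S/2}` contains `p` is one of three per coordinate.
[cite: Balaban1984PropagatorsII, p.229 («each cube being a sum of 2^d big blocks»), bookkeeping] -/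
theorem near_coord_collar (hMh : 1 ≤ Mh) {i : ↥(B6Cover236MultiLevelBlocksL0.cubes D)} {p : Fin (d + 1) → ℝ} (h : dist p (ctr D i) < 3 / 2 * side D i)
    (μ : Fin (d + 1)) : i.1.2 μ - ⌊p μ / side D i - 2⌋ ∈ ({1, 2, 3} : Finset ℤ) := by
  have hS := side_pos D hMh i
  have hμ := lt_of_le_of_lt (dist_le_pi_dist p (ctr D i) μ) h
  rw [Real.dist_eq] at hμ
  set u : ℝ := p μ / side D i - 2 with hu
  -- `|p_μ/S − 1/2 − β| < 3/2`
  have hβ : |u + 3 / 2 - (i.1.2 μ : ℝ)| < 3 / 2 := by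
    have e : u + 3 / 2 - (i.1.2 μ : ℝ) = (p μ - ctr D i μ) / side D i := by
      rw [hu]; unfold ctr; field_simp; ring
    rw [e, abs_div, abs_of_pos hS, div_lt_iff₀ hS]
    nlinarith
  have h1 := Int.floor_le u
  have h2 := Int.lt_floor_add_one u
  rw [abs_lt] at hβ
  have hge : ⌊u⌋ + 1 ≤ i.1.2 μ := by
    by_contra hlt
    have : (i.1.2 μ : ℝ) ≤ (⌊u⌋ : ℝ) := by exact_mod_cast (show i.1.2 μ ≤ ⌊u⌋ by omega)
    linarith
  have hle : i.1.2 μ ≤ ⌊u⌋ + 3 := by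
    by_contra hlt
    have : (⌊u⌋ : ℝ) + 4 ≤ (i.1.2 μ : ℝ) := by exact_mod_cast (show ⌊u⌋ + 4 ≤ i.1.2 μ by omega)
    linarith
  simp only [Finset.mem_insert, Finset.mem_singleton]; omega

/-- **FINITE OVERLAP AT FINE SITES**: at most `3^{d+2}` cubes have a given fine site in their collar `{|x − ctr|_∞ < 3S/2}` (levels `lev x − 1 … lev x + 1`
by file 1's window, three labels per coordinate) — in particular at most `3^{d+2}` of the `h_□` are non-zero at `x` or within `S_□/2` of `x`.
[cite: Balaban1984PropagatorsII, p.229 («each cube being a sum of 2^d big blocks»)] -/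
theorem card_collar_le (hMh : 1 ≤ Mh) (hR : 2 * (ℓ + 1) ≤ R) (x : ↥(boxDom (N0 ℓ Mh k P))) :
    #(Finset.univ.filter fun i : ↥(B6Cover236MultiLevelBlocksL0.cubes D) => dist (toR x.1) (ctr D i) < 3 / 2 * side D i) ≤ 3 ^ (d + 2) := by
  classical
  set m : ℕ → Fin (d + 1) → ℤ := fun j μ => ⌊toR x.1 μ / (bigSide ℓ Mh j : ℝ) - 2⌋ with hm
  set T : Finset (ℕ × (Fin (d + 1) → ℤ)) := (Finset.Icc (D.lev x.1 - 1) (D.lev x.1 + 1)).biUnion fun j =>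
    (Fintype.piFinset fun _ : Fin (d + 1) => ({1, 2, 3} : Finset ℤ)).image fun e => (j, fun μ => m j μ + e μ) with hT
  have hT3 : #T ≤ 3 ^ (d + 2) := by
    refine Finset.card_biUnion_le.trans ?_
    calc ∑ j ∈ Finset.Icc (D.lev x.1 - 1) (D.lev x.1 + 1),
          #((Fintype.piFinset fun _ : Fin (d + 1) => ({1, 2, 3} : Finset ℤ)).image fun e => (j, fun μ => m j μ + e μ))
        ≤ ∑ _j ∈ Finset.Icc (D.lev x.1 - 1) (D.lev x.1 + 1), 3 ^ (d + 1) := Finset.sum_le_sum fun j _ => by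
          refine Finset.card_image_le.trans (le_of_eq ?_)
          rw [Fintype.card_piFinset_const]; simp
      _ = #(Finset.Icc (D.lev x.1 - 1) (D.lev x.1 + 1)) * 3 ^ (d + 1) := by rw [Finset.sum_const, smul_eq_mul]
      _ ≤ 3 * 3 ^ (d + 1) := by rw [Nat.card_Icc]; exact Nat.mul_le_mul_right _ (by omega)
      _ = 3 ^ (d + 2) := by ring
  have hsub : (Finset.univ.filter fun i : ↥(cubes D) => dist (toR x.1) (ctr D i) < 3 / 2 * side D i).map
      ⟨Subtype.val, Subtype.val_injective⟩ ⊆ T := by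
    intro c hc
    rw [Finset.mem_map] at hc
    obtain ⟨i, hi, rfl⟩ := hc
    have hdist := (Finset.mem_filter.1 hi).2
    have hw := lev_window_of_dist_lt_three_halves D hMh hR (i := i) (x := x) hdist
    rw [hT, Finset.mem_biUnion]
    refine ⟨i.1.1, by rw [Finset.mem_Icc]; omega, ?_⟩
    rw [Finset.mem_image]
    refine ⟨fun μ => i.1.2 μ - m i.1.1 μ, ?_, ?_⟩
    · rw [Fintype.mem_piFinset]; intro μ; exact near_coord_collar D hMh hdist μ
    · show (i.1.1, fun μ => m i.1.1 μ + (i.1.2 μ - m i.1.1 μ)) = i.1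
      refine Prod.ext rfl (funext fun μ => ?_)
      show m i.1.1 μ + (i.1.2 μ - m i.1.1 μ) = i.1.2 μ
      ring
  calc #(Finset.univ.filter fun i : ↥(cubes D) => dist (toR x.1) (ctr D i) < 3 / 2 * side D i)
      = #((Finset.univ.filter fun i : ↥(cubes D) => dist (toR x.1) (ctr D i) < 3 / 2 * side D i).map
          ⟨Subtype.val, Subtype.val_injective⟩) := (Finset.card_map _).symm
    _ ≤ #T := Finset.card_le_card hsub
    _ ≤ 3 ^ (d + 2) := hT3

/-! ## §3  Comparable scales -/

/-- **CUBES ACTIVE NEAR ONE SITE HAVE COMPARABLE SCALES**: if the `3S/2`-collars of two cubes share a fine site, their levels differ by at most `2`,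
so `8S/5 ≤ L²·8S′/5`. [cite: Balaban1984PropagatorsII, (2.2) p.224, p.235, bookkeeping] -/
theorem sF_le_Lsq_mul_sF (hMh : 1 ≤ Mh) (hR : 2 * (ℓ + 1) ≤ R) {i c : ↥(B6Cover236MultiLevelBlocksL0.cubes D)} {x : ↥(boxDom (N0 ℓ Mh k P))}
    (hi : dist (toR x.1) (ctr D i) < 3 / 2 * side D i) (hc : dist (toR x.1) (ctr D c) < 3 / 2 * side D c) :
    sF D i ≤ ((ℓ : ℝ) + 1) ^ 2 * sF D c := by
  have h1 := lev_window_of_dist_lt_three_halves D hMh hR hi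
  have h2 := lev_window_of_dist_lt_three_halves D hMh hR hc
  have h := side_le_Lsq_mul_side D (i := i) (i' := c) (by omega)
  unfold sF
  nlinarith [h]

/-! ## §4  First differences of `h_□` at neighbouring fine sites -/

/-- a move of sup-length `≤ ρ` takes a point of a cube □ (`|p − ctr|_∞ < S`) into `{|q − ctr|_∞ < S + ρ}`. [cite: Balaban1984PropagatorsII, p.229, bookkeeping] -/
theorem dist_collar_of_near {i : ↥(B6Cover236MultiLevelBlocksL0.cubes D)} {p q : Fin (d + 1) → ℝ} {ρ : ℝ} (hp : dist p (ctr D i) < side D i) (hpq : dist p q ≤ ρ) :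
    dist q (ctr D i) < side D i + ρ := by
  have := dist_triangle q p (ctr D i); rw [dist_comm q p] at this; linarith

/-- **LEVEL-0 JOINT** (programme G-F3′-L0): `S ≥ L·M_h` for EVERY cube, level `0` included (the twin's `one_le_level` /
`Lsq_mul_le_side : L²·M_h ≤ S` are statements about levels `≥ 1` and are not twinned: a level-`0` cube has side `L·M_h`).
[cite: Balaban1984PropagatorsII, (2.1) p.224, p.229 («cubes □ of the size 2ML^jη … for all j from 0 to k»), bookkeeping] -/
theorem L_mul_le_side (i : ↥(cubes D)) : ((ℓ : ℝ) + 1) * Mh ≤ side D i := by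
  rw [side_eq]
  have h1 : (ℓ + 1) ^ 1 ≤ (ℓ + 1) ^ (i.1.1 + 1) := Nat.pow_le_pow_right (by omega) (by omega)
  have h1r : ((ℓ : ℝ) + 1) ≤ (((ℓ + 1) ^ (i.1.1 + 1) : ℕ) : ℝ) := by rw [pow_one] at h1; exact_mod_cast h1
  have hM0 : (0 : ℝ) ≤ Mh := by positivity
  nlinarith

/-- **LEVEL-0 JOINT**: `2L² ≤ S` for every cube once `M_h ≥ 2L` — the size condition under which ONE fine-lattice step stays inside the
range `ρ ≤ S/(2L²)` of `abs_hF_sub_le_of_dist_le` also for the level-`0` cubes (side `L·M_h`); print's «M sufficiently large» (chosen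
after `L`). [cite: Balaban1984PropagatorsII, p.229, (2.92) p.239 line 1, bookkeeping] -/
theorem two_Lsq_le_side (hMh : 2 * (ℓ + 1) ≤ Mh) (i : ↥(cubes D)) : 2 * ((ℓ : ℝ) + 1) ^ 2 ≤ side D i := by
  have h := L_mul_le_side D i
  have hM : 2 * ((ℓ : ℝ) + 1) ≤ Mh := by exact_mod_cast hMh
  have hL : (0 : ℝ) ≤ (ℓ : ℝ) + 1 := by positivity
  nlinarith

/-- **`|h_□(x′) − h_□(x)| ≤ C₁·ρ/(8S/5)` FOR FINE SITES AT SUP-DISTANCE `≤ ρ ≤ S/(2L²)`** («|∂^ηh_□| ≤ O(1)(ML^jη)^{−1}» with the normalisation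
across the `≤ 3^{d+2}` active cubes of comparable scales; the range `S/(2L²)` keeps both sites in the `3S′/2`-collar of every active cube).
[cite: Balaban1984PropagatorsII, p.247 after (2.134), (2.92) p.239 line 1] -/
theorem abs_hF_sub_le_of_dist_le (hℓ : 1 ≤ ℓ) (hMh : 1 ≤ Mh) (hR : 2 * (ℓ + 1) ≤ R) (i : ↥(B6Cover236MultiLevelBlocksL0.cubes D))
    {x x' : ↥(boxDom (N0 ℓ Mh k P))} {ρ : ℝ} (hxx' : dist (toR x.1) (toR x'.1) ≤ ρ) (hρ : ρ ≤ side D i / (2 * ((ℓ : ℝ) + 1) ^ 2)) :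
    |hF D i x' - hF D i x| ≤ C1F d ℓ * ρ / sF D i := by
  have hS := side_pos D hMh i
  have hs := sF_pos D hMh i
  have hD1 := D1_nonneg contDiff_hprof hasCompactSupport_hprof
  have hL4 : (4 : ℝ) ≤ ((ℓ : ℝ) + 1) ^ 2 := by
    have h0 : (1 : ℝ) ≤ ℓ := by exact_mod_cast hℓ
    nlinarith
  have hL1 : (1 : ℝ) ≤ ((ℓ : ℝ) + 1) ^ 2 := by linarith
  have hρ0 : 0 ≤ ρ := dist_nonneg.trans hxx'
  have hρS : ρ ≤ side D i / 8 := hρ.trans (by rw [div_le_div_iff₀ (by positivity) (by norm_num)]; nlinarith)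
  -- trivial when `θ_□` vanishes at both sites
  by_cases h0 : thetaF D i (toR x.1) = 0 ∧ thetaF D i (toR x'.1) = 0
  · have e1 : hF D i x = 0 := by unfold hF; rw [h0.1, zero_div]
    have e2 : hF D i x' = 0 := by unfold hF; rw [h0.2, zero_div]
    rw [e1, e2, sub_zero, abs_zero]; exact div_nonneg (mul_nonneg (C1F_nonneg d ℓ) hρ0) hs.le
  -- otherwise both sites are in the `3S/2`-collar of □
  have hxi : dist (toR x.1) (ctr D i) < side D i + ρ := by
    rcases not_and_or.1 h0 with h | h
    · have := dist_lt_of_thetaF_ne_zero D hMh h; linarith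
    · exact dist_collar_of_near D (ρ := ρ) (dist_lt_of_thetaF_ne_zero D hMh h) (by rw [dist_comm]; exact hxx')
  have hxi' : dist (toR x.1) (ctr D i) < 3 / 2 * side D i := by linarith
  have hx'i : dist (toR x'.1) (ctr D i) < 3 / 2 * side D i := by
    have := dist_triangle (toR x'.1) (toR x.1) (ctr D i); rw [dist_comm (toR x'.1) (toR x.1)] at this; linarith
  have hwx' := lev_window_of_dist_lt_three_halves D hMh hR hx'i
  -- the active set: cubes whose `3S′/2`-collar contains `x`
  classical
  set A := Finset.univ.filter fun c : ↥(cubes D) => dist (toR x.1) (ctr D c) < 3 / 2 * side D c with hA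
  have hAcard : (#A : ℝ) ≤ 3 ^ (d + 2) := by exact_mod_cast card_collar_le D hMh hR x
  have hmemA : ∀ c : ↥(cubes D), (thetaF D c (toR x.1) ≠ 0 ∨ thetaF D c (toR x'.1) ≠ 0) → c ∈ A := by
    intro c hc
    rw [hA, Finset.mem_filter]
    refine ⟨Finset.mem_univ _, ?_⟩
    have hSc := side_pos D hMh c
    rcases hc with h | h
    · have := dist_lt_of_thetaF_ne_zero D hMh h; linarith
    · -- `c` is active at `x′`, so `lev x′ ≤ j_c + 1`, and `lev x′ ≥ j − 1`: `S ≤ L²S_c`, `ρ ≤ S_c/2`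
      have hc' := dist_lt_of_thetaF_ne_zero D hMh h
      have hwc := B6Partition118KLevelFineL0.lev_window_of_dist_lt D hMh hR hc'
      have hcmp := side_le_Lsq_mul_side D (i := i) (i' := c) (by omega)
      have hρc : ρ ≤ side D c / 2 := by
        refine hρ.trans ?_
        rw [div_le_div_iff₀ (by positivity) two_pos]; nlinarith
      have := dist_collar_of_near D (ρ := ρ) hc' (by rw [dist_comm]; exact hxx')
      linarith
  -- each active bump moves by at most `(d+1)D₁L²ρ/(8S/5)`
  have hterm : ∀ c ∈ A, |thetaF D c (toR x'.1) ^ 2 - thetaF D c (toR x.1) ^ 2| ≤ 2 * (((d : ℝ) + 1) * D1 hprof * ((ℓ : ℝ) + 1) ^ 2 * ρ / sF D i) := by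
    intro c hc
    have hcd := (Finset.mem_filter.1 hc).2
    have hsc := sF_pos D hMh c
    have hcmp := sF_le_Lsq_mul_sF D hMh hR hxi' hcd
    refine (abs_sq_sub_sq_le (thetaF_nonneg D c _) (thetaF_le_one D c _) (thetaF_nonneg D c _) (thetaF_le_one D c _)).trans ?_
    refine mul_le_mul_of_nonneg_left ?_ zero_le_two
    calc |thetaF D c (toR x'.1) - thetaF D c (toR x.1)| ≤ ((d : ℝ) + 1) * D1 hprof / sF D c * dist (toR x'.1) (toR x.1) :=
          abs_thetaF_sub_le D hMh c _ _
      _ ≤ ((d : ℝ) + 1) * D1 hprof / sF D c * ρ := mul_le_mul_of_nonneg_left (by rwa [dist_comm]) (by positivity)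
      _ = ((d : ℝ) + 1) * D1 hprof * ρ * (((ℓ : ℝ) + 1) ^ 2 / (((ℓ : ℝ) + 1) ^ 2 * sF D c)) := by field_simp
      _ ≤ ((d : ℝ) + 1) * D1 hprof * ρ * (((ℓ : ℝ) + 1) ^ 2 / sF D i) := by
          refine mul_le_mul_of_nonneg_left (div_le_div_of_nonneg_left (by positivity) hs hcmp) (by positivity)
      _ = ((d : ℝ) + 1) * D1 hprof * ((ℓ : ℝ) + 1) ^ 2 * ρ / sF D i := by ring
  -- the normalising sums differ by the active terms only
  have hN : |nsqF D x' - nsqF D x| ≤ #A * (2 * (((d : ℝ) + 1) * D1 hprof * ((ℓ : ℝ) + 1) ^ 2 * ρ / sF D i)) := by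
    unfold nsqF
    rw [← Finset.sum_sub_distrib]
    have hzero : ∀ c ∉ A, thetaF D c (toR x'.1) ^ 2 - thetaF D c (toR x.1) ^ 2 = 0 := by
      intro c hc
      have h1 : thetaF D c (toR x.1) = 0 := by by_contra h; exact hc (hmemA c (Or.inl h))
      have h2 : thetaF D c (toR x'.1) = 0 := by by_contra h; exact hc (hmemA c (Or.inr h))
      rw [h1, h2]; ring
    rw [← Finset.sum_filter_add_sum_filter_not Finset.univ (fun c => c ∈ A), Finset.sum_eq_zero (fun c hc => hzero c (Finset.mem_filter.1 hc).2),
      add_zero, Finset.filter_mem_eq_inter, Finset.univ_inter]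
    calc |∑ c ∈ A, (thetaF D c (toR x'.1) ^ 2 - thetaF D c (toR x.1) ^ 2)|
        ≤ ∑ c ∈ A, |thetaF D c (toR x'.1) ^ 2 - thetaF D c (toR x.1) ^ 2| := Finset.abs_sum_le_sum_abs _ _
      _ ≤ ∑ _c ∈ A, 2 * (((d : ℝ) + 1) * D1 hprof * ((ℓ : ℝ) + 1) ^ 2 * ρ / sF D i) := Finset.sum_le_sum hterm
      _ = _ := by rw [Finset.sum_const, nsmul_eq_mul]
  -- assemble with the quotient rule
  have hq := quot_diff_le (f := thetaF D i (toR x.1)) (f' := thetaF D i (toR x'.1)) (thetaF_nonneg D i _) (thetaF_le_one D i _)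
    (one_le_nsqF D hMh x) (one_le_nsqF D hMh x')
  have hθ : |thetaF D i (toR x'.1) - thetaF D i (toR x.1)| ≤ ((d : ℝ) + 1) * D1 hprof * ρ / sF D i := by
    calc |thetaF D i (toR x'.1) - thetaF D i (toR x.1)| ≤ ((d : ℝ) + 1) * D1 hprof / sF D i * dist (toR x'.1) (toR x.1) :=
          abs_thetaF_sub_le D hMh i _ _
      _ ≤ ((d : ℝ) + 1) * D1 hprof / sF D i * ρ := mul_le_mul_of_nonneg_left (by rwa [dist_comm]) (by positivity)
      _ = _ := by ring
  unfold hF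
  refine hq.trans ?_
  have hK0 : 0 ≤ ((d : ℝ) + 1) * D1 hprof * ((ℓ : ℝ) + 1) ^ 2 * ρ / sF D i := by positivity
  calc |thetaF D i (toR x'.1) - thetaF D i (toR x.1)| + |nsqF D x' - nsqF D x| / 2
      ≤ ((d : ℝ) + 1) * D1 hprof * ρ / sF D i + (3 ^ (d + 2) * (2 * (((d : ℝ) + 1) * D1 hprof * ((ℓ : ℝ) + 1) ^ 2 * ρ / sF D i))) / 2 := by
        refine add_le_add hθ (div_le_div_of_nonneg_right (hN.trans (mul_le_mul_of_nonneg_right hAcard (by positivity))) zero_le_two)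
    _ = C1F d ℓ * ρ / sF D i := by unfold C1F; field_simp

/-- **`|h_□(x′) − h_□(x)| ≤ C₁/(8S/5)` FOR NEIGHBOURING FINE SITES** (sup-distance `≤ 1`; **`M_h ≥ 2L`** puts `1 ≤ S/(2L²)` for every
cube, the level-`0` cubes of side `L·M_h` included — LEVEL-0 JOINT of programme G-F3′-L0: the twin's binder `2 ≤ M_h` is strengthened IN
PLACE to `2·L ≤ M_h`, same name and position): the size `|∂^ηh_□| ≤ O(1)(ML^jη)^{−1}` of line 1 of (2.92), per fine-lattice step.
[cite: Balaban1984PropagatorsII, p.247 after (2.134), (2.92) p.239 line 1] -/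
theorem abs_hF_sub_le_near (hℓ : 1 ≤ ℓ) (hMh : 2 * (ℓ + 1) ≤ Mh) (hR : 2 * (ℓ + 1) ≤ R) (i : ↥(cubes D))
    {x x' : ↥(boxDom (N0 ℓ Mh k P))}
    (hxx' : dist (toR x.1) (toR x'.1) ≤ 1) : |hF D i x' - hF D i x| ≤ C1F d ℓ / sF D i := by
  have hMh1 : 1 ≤ Mh := le_trans (by omega) hMh
  have hL : (0 : ℝ) < ((ℓ : ℝ) + 1) ^ 2 := by positivity
  have h1 : (1 : ℝ) ≤ side D i / (2 * ((ℓ : ℝ) + 1) ^ 2) := by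
    rw [le_div_iff₀ (by positivity), one_mul]
    have := two_Lsq_le_side D hMh i
    linarith
  simpa only [mul_one] using abs_hF_sub_le_of_dist_le D hℓ hMh1 hR i hxx' h1

end Literature.MathematicalPhysics.QuantumFieldTheory.Balaban1983to89.B6Partition118KLevelFineSizesL0
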